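import Summits.BirchSwinnertonDyer.Rank1Residual.X2.ResidualDevissageLine
import HarnessLib

/-!
# GV display (16) devissage for ANY Greenberg data whose `p`-torsion plus-part IS the even rational line
# — the `I_p`-triviality hypothesis of the X2 kernel (`ResidualDevissageLine.natCard_gvSelmer_torsion_eq_mul_of_line`)
# replaced by the identification `C ∩ E[p^∞][p] = Φ₀` it was used for (cell `bsd-addord`, seat
# `bsd-addord-twist`; step (d) of the road map for the algebraic count `hAlgW` at an ADDITIVE prime,
# memo v2.1 §7)

HONEST FRAMING (cell `bsd-addord`, `run/shared/lean/pub/bsd-addord/README.md` §4): the programme's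
target of record is the full Birch–Swinnerton-Dyer formula for every `E/ℚ` of analytic rank `≤ 1`;
this file is a TOOL theorem toward the one open input `hAlgW` (Greenberg–Vatsal's (16)+(11) for
`Sel_{p^∞}(E/ℚ_∞)` at an additive prime) of the seat's X3 end-state files
(`X3BranchAnalyticHalfGordDescent[EndState].lean`); it books NOTHING. THEOREMS ONLY (no `def`, no
named fact, no `sorry`).

## What and why

The X2 kernel proves GV's display (16) — `#S^{Σ₀}_{E[p]}(L) = #H¹(ℚ_Σ/L, Φ₀) · #S^{Σ₀}_{E[p]/Φ₀}(L)`
— as `ResidualDevissageLine.natCard_gvSelmer_torsion_eq_mul_of_line` for Greenberg data `L` on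
`E[p^∞]` whose graded piece is `I_p`-TRIVIAL (`htriv`) with residual line of order `p` (`hcard`) and a
rational line `Φ₀` RAMIFIED at `p` (`hram`): these three hypotheses serve only to identify the
`p`-torsion plus-part of the datum with `Φ₀` (`torsionData_plus_eq_lineSub`, Serre's inertia line);
the devissage itself (`ResidualDevissageSelmer.natCard_datumSelmer_eq_mul`) is general. At an
ADDITIVE potentially ordinary prime (the twisted / ramified ordinary datum of the seat's X3 rows,
`Additive/GreenbergKummerTwistDescent`, `IsRamifiedOrdinaryLine`) the graded piece is NOT
`I_p`-trivial (inertia acts through `ω^{(p−1)/2}`, GV Remark (2.9)'s case `D^{I_p} = 0`), so `htriv`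
fails — but the identification `C ∩ E[p] = Φ₀` still holds there for the EVEN line whose
`χ_{p*}`-twist is ramified (the unique `ω^{(p+1)/2}`-eigenline). THIS FILE states the devissage with
that identification as the hypothesis (`hplus`), for every Greenberg data `L`:
`X3TwistedDatum.natCard_gvSelmer_torsion_eq_mul_of_plus_eq_line`. The remaining hypotheses are the
general ones of the X2 theorem (`Φ₀` even, `p` odd, `H ∋` a complex conjugation, `Σ₀ ⊇` the bad
places `≠ p`, the lifting property `hlift` = GV p. 30 `H²(ℚ_Σ/ℚ_∞, Φ) = 0`, in the tree as the
reading-fact `residualEpsilon_surjOn_of_lineRamifiedEven` on the ramified-even rows).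

References: [GreenbergVatsal2000] §2 pp. 28–30 (display (16)), Remark (2.9) (p. 25);
HOME `bsd-addord-twist-MEMO-v2.md` §7 (road map (d)).
-/

noncomputable section

open scoped Classical AddSubgroup

namespace Summit.BirchSwinnertonDyer.Rank1Residual.Additive.X3TwistedDatum

open WeierstrassCurve Literature.NumberTheory.EllipticCurves Literature.NumberTheory.GaloisRepresentations
  Field IsDedekindDomain NumberField
  Literature.NumberTheory.EllipticCurves.GreenbergSelmer
  Literature.NumberTheory.EllipticCurves.Rank1Residual
  Summit.BirchSwinnertonDyer.Rank1Residual.X2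
  Summit.BirchSwinnertonDyer.Rank1Residual.X2.GreenbergVatsalTorsion
  Summit.BirchSwinnertonDyer.Rank1Residual.X2.GreenbergVatsalTateDatumCofree
  Summit.BirchSwinnertonDyer.Rank1Residual.X2.ResidualDevissageModules
  Summit.BirchSwinnertonDyer.Rank1Residual.X2.ResidualDevissageSelmer
  Summit.BirchSwinnertonDyer.Rank1Residual.X2.ResidualDevissageLine

variable {W : WeierstrassCurve ℚ} {p : ℕ} [hp : Fact p.Prime] [W.IsElliptic]
  {Φ₀ : AddSubgroup (geomTorsion W (p : ℤ))} (hΦ : IsRationalLine W p Φ₀)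

/-- **GV display (16) for ANY Greenberg data whose `p`-torsion plus-part is the even rational line
`Φ₀`.** `E/ℚ` elliptic, `p` odd; `Φ₀ ≤ E[p]` a rational line, EVEN; `L` Greenberg data on `E[p^∞]`
above `p` with `(torsionDatum (L v) p).plus = Φ₀` for every `v ∣ p` (`hplus` — at a good ordinary or
multiplicative prime this is `torsionData_plus_eq_lineSub` for the ramified `Φ₀`; at an additive
potentially ordinary prime it is the ramified-twist position of the even line); `Σ₀ ⊇` the bad places
prime to `p`; `H ≤ Γ_ℚ` normal containing a complex conjugation; the lifting property `hlift`. Then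
`#S^{Σ₀}_{E[p]}(L) = #H¹(ℚ_Σ/L, Φ₀) · #S^{Σ₀}_{E[p]/Φ₀}(L)`. Proof = the X2 proof verbatim with its
second bullet replaced by `hplus` (`natCard_datumSelmer_eq_mul`; `E[p^∞][p]` unramified outside
`Σ₀ ∪ {p}`; `(E[p]/Φ₀)^H = 0` because `Φ₀` is even, `forall_fixed_quot_eq_zero`).
[cite: GreenbergVatsal2000, §2 pp. 28–30 (display (16)) and Remark (2.9) (p. 25)] -/
theorem natCard_gvSelmer_torsion_eq_mul_of_plus_eq_line (hp2 : p ≠ 2) (heven : LineEven W p Φ₀)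
    (L : Data ℚ (W.geomPrimaryTorsion p) p)
    (hplus : ∀ (v : HeightOneSpectrum (𝓞 ℚ)) (hv : ((p : ℕ) : 𝓞 ℚ) ∈ v.asIdeal),
      (torsionDatum (L v hv) p).plus = (lineSub Φ₀ hΦ).toAddSubgroup)
    (S₀ : Set (HeightOneSpectrum (𝓞 ℚ)))
    (hS : ∀ v : HeightOneSpectrum (𝓞 ℚ), v ∉ S₀ → ((p : ℕ) : 𝓞 ℚ) ∉ v.asIdeal →
      W.HasGoodReductionAt v)
    (H : Subgroup (absoluteGaloisGroup ℚ)) [H.Normal] {c : absoluteGaloisGroup ℚ} (hcH : c ∈ H)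
    (hc : IsComplexConjugation (Rat.castHom ℝ) c)
    (hlift : ∀ s ∈ quotSelmer H (lineSub Φ₀ hΦ).Quot p S₀,
      ∃ x ∈ GreenbergVatsal2000.unramifiedOutside H ↥((↥(W.geomPrimaryTorsion p))[(p : ℤ)]) p S₀,
        subH1 H (lineSub Φ₀ hΦ).proj (lineSub Φ₀ hΦ).proj_smul x = s) :
    Nat.card (gvSelmer H ↥((↥(W.geomPrimaryTorsion p))[(p : ℤ)]) p (torsionData L p) S₀) =
      Nat.card (GreenbergVatsal2000.unramifiedOutside H (lineSub Φ₀ hΦ).Sub p S₀) *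
        Nat.card (quotSelmer H (lineSub Φ₀ hΦ).Quot p S₀) := by
  set S := lineSub Φ₀ hΦ with hSdef
  rw [GreenbergVatsalTateDatumCofree.gvSelmer_eq_datumSelmer]
  refine natCard_datumSelmer_eq_mul (i := S.incl) (q := S.proj) S.incl_smul S.proj_smul
    (continuous_smul_torsion (W := W) (p := p)) S.incl_injective S.proj_surjective
    S.mem_range_incl_of_proj_eq_zero S.proj_incl ?_ ?_ ?_ hlift
  · intro v hv hpv x hx m
    apply Subtype.ext
    rw [AddSubgroup.torsionBy.coe_smul]
    exact GreenbergVatsalTorsionCurve.unramified_outside W p S₀ hS v hv hpv x hx _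
  · intro v hv
    rw [S.ker_proj]
    exact hplus v hv
  · exact ResidualDevissage.surjOn_fixed_of_forall_fixed_eq_zero S.proj
      (fun y hy ↦ forall_fixed_quot_eq_zero hΦ hp2 heven H hcH hc y hy)

end Summit.BirchSwinnertonDyer.Rank1Residual.Additive.X3TwistedDatum

end
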